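import Summits.BirchSwinnertonDyer.BirchSwinnertonDyer.Theorems.PrintCf2SplitBadTwoFrameSupplyV10Adapted
import Summits.BirchSwinnertonDyer.BirchSwinnertonDyer.Theorems.PrintCf2SplitBadTwoDoublyAdaptedPair
import HarnessLib

/-!
# Crux `PrintCf2.SplitBadTwoRankOneOfFacts` (stmt-BirchSwinnertonDyer-20368), road α — S1-v10d: the v10 FRAME SUPPLY with the
# DOUBLY-ADAPTED generator pair AND THE FRAME FIELD NAMED (`NumberField.discr K = −7`, i.e. `K = ℚ(√−7)`)

Cell `bsd-print-cf2`, LEAD seat `bsd-line-cf2-p1` g14 (prover-bsd-line-cf2-p1-g14-0); `--supports stmt-BirchSwinnertonDyer-20368`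
(helper, Theses-free). HONEST FRAMING: a STRENGTHENING of -w2 g13's supply theorem `RubinValueTwoV10.frameSupply_two_v10c_of_quadraticPart`
(p692577, `…FrameSupplyV10DoublyAdapted.lean`) by ONE conjunct — `NumberField.discr K = -7` — which the proof already had in hand
(`Quadratic.exists_numberField_discr_eq (D := -7)`) and merely did not display; everything else VERBATIM (same hypotheses `hQ`, GZK,
Deuring; same proof). WHY (LEAD g14 ruling R-DA7, 2026-08-29): the skeleton of record v13.5 states S3a-quad for DOUBLY-ADAPTED frames over
THE class field `K = ℚ(√−7)` only (`stub_twoVariableMC_two_quadDA`), so that the DECIDING research child 24086's equality line M-LINE-PIN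
(planner g19) pins on the `v`-line of `ℚ(√−7)`, where `v̄` is UNDECOMPOSED (`LinePin.exists_mem_decomp_vbar_apply_eq_of_isUnramifiedOutside`,
p703191) and the `v̄`-Euler factor is `(1+T) − θ(Frob_v̄)` (cf2c-w8 g4's class statement `LinePin.exists_charIdeal_ker_liftQ_charModule_of_frame`,
p703191-lineage) — no change-of-pair covariance, no general-index Euler factor. Nothing here closes a stub; no definition, no named fact beyond
the two antecedents already carried by v10b/v10c, no `sorry`.

presearch: not applicable (assembly of tree theorems). beyond-print theorem: no. BSD is not proved by any of this; no summit
statement is proved by this seat.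

References: [deShalit1987] II.4.17 (54); [Washington1997] §13.1, Thm. 13.4; [Agboola2007] §1 p. 1, §6 Thm. 6.12; [GrossZagier1986] Thm. I.(7.3).
-/

set_option autoImplicit false
set_option linter.dupNamespace false

noncomputable section

open scoped Classical
open NumberField IsDedekindDomain Field WeierstrassCurve
open Literature.NumberTheory.GaloisRepresentations Literature.NumberTheory.EllipticCurves
open Literature.NumberTheory.EllipticCurves.Rank1Residual
open Literature.NumberTheory.EllipticCurves.DeShalit1987

namespace Summit.BirchSwinnertonDyer.BirchSwinnertonDyer.Theorems.PrintCf2.RubinValueTwoV10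

/-- **S1-v10d — the v10 frame supply with the DOUBLY-ADAPTED generator pair over THE NAMED class field `K = ℚ(√−7)`
(`NumberField.discr K = -7` displayed)**: as `frameSupply_two_v10c_of_quadraticPart` (p692577), itself as `frameSupply_two_v10b_of_quadraticPart`
(frame field `K = ℚ(√−7)`, `2 = v v̄`, `2 ∤ h_K`, datum `ι`, complex conjugation `c`, Deuring's `ψ`, the quadratic-part socket
`θ, θK, ρ, r, Sθ`, values on the open bidisc, the Mordell–Weil generator and formal-group clause, `Finite W.sha`) with the generator
pair `(κ₁, κ₂; γ₁, γ₂)` now DOUBLY adapted: `κ₁` unramified outside `v`, `κ₂` unramified outside `v̄`, `γ₁ ∈ I_v`, `γ₂ ∈ I_{v̄}`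
(chosen inertia groups), plus the conjunct `NumberField.discr K = -7`.  Proof: v10c's VERBATIM, displaying `hdK`.
[cite: deShalit1987, II.4.17 (54)] [cite: Washington1997, §13.1 and Thm. 13.4] [cite: Agboola2007, §1 p. 1 and §6 Thm. 6.12]
[cite: GrossZagier1986, Thm. I.(7.3)] -/
theorem frameSupply_two_v10d_of_quadraticPart
    (hQ : ∀ (d : ℤ), d ≠ 0 → ∀ (W : WeierstrassCurve ℚ) [W.IsElliptic] [W.IsGloballyMinimal] (C : VariableChange ℚ),
      C • W = cm7.quadraticTwist (d : ℚ) →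
      ∀ (K : Type) [Field K] [NumberField K], IsImaginaryQuadratic K →
      ∀ (v vbar : HeightOneSpectrum (𝓞 K)),
        ((2 : ℕ) : 𝓞 K) ∈ v.asIdeal → ((2 : ℕ) : 𝓞 K) ∈ vbar.asIdeal → vbar ≠ v →
      ∀ (ι : PadicAlgCl 2 ≃+* ℂ),
        (∀ (w : InfinitePlace K) (k : 𝓞 K), k ∈ v.asIdeal ↔ ‖ι.symm (w.embedding (k : K))‖ < 1) →
      ∀ (c : K ≃ₐ[ℚ] K), c ≠ 1 →
      ∀ (ψ : HeckeCharacter K), ψ.HasInfinityType (fun _ ↦ 1) (fun _ ↦ 0) → IsHeckeConjEquivariant c ψ →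
        (∀ s : ℂ, 3 / 2 < s.re → heckeLFunction ψ s = W.LSeries s) →
      ∀ (κ₁ κ₂ : ZpExtension K 2) (γ₁ γ₂ : absoluteGaloisGroup K), ZpExtension.IsTopGeneratorPair κ₁ κ₂ γ₁ γ₂ →
      ∃ (θ : FramedGaloisRep K (padicCoeffIntegers (∅ : Set (PadicAlgCl 2))) 1)
        (θK ρ : HeckeCharacter K) (r : FramedGaloisRep K (PadicAlgCl 2) 1) (Sθ : Finset (HeightOneSpectrum (𝓞 K))),
        (∀ σ : absoluteGaloisGroup K, θ σ ^ 2 = 1) ∧ KellerYin2024.IsHeckeCharOf ι θ θK ∧ θK * θK = 1 ∧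
        IsPAdicAvatarOf ι ρ r ∧ FactorsThroughPair κ₁ κ₂ r ∧ θK⁻¹ * ρ = (HeckeCharacter.galConj c ψ)⁻¹ ∧
        v ∉ Sθ ∧ vbar ∉ Sθ ∧ (∀ w ∈ Sθ, ¬ θK.IsUnramifiedAt w) ∧
        (∀ w : HeightOneSpectrum (𝓞 K), w ∉ Sθ → w ≠ v → w ≠ vbar → θK.IsUnramifiedAt w) ∧
        ‖avatarValueAt r γ₁⁻¹ - 1‖ < 1 ∧ ‖avatarValueAt r γ₂⁻¹ - 1‖ < 1) :
    rank_eq_analyticRank_of_analyticRank_le_one → Deuring_exists_heckeCharacter_of_maximalCM →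
    ∀ (d : ℤ), d ≠ 0 → Squarefree d → d % 4 ≠ 1 →
    ∀ (W : WeierstrassCurve ℚ) [W.IsElliptic] [W.IsGloballyMinimal] (C : VariableChange ℚ),
      C • W = cm7.quadraticTwist (d : ℚ) → W.analyticRank = 1 →
    ∃ (K : Type) (_ : Field K) (_ : NumberField K) (v vbar : HeightOneSpectrum (𝓞 K))
      (ι : PadicAlgCl 2 ≃+* ℂ) (c : K ≃ₐ[ℚ] K) (ψ : HeckeCharacter K)
      (κ₁ κ₂ : ZpExtension K 2) (γ₁ γ₂ : absoluteGaloisGroup K)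
      (θ : FramedGaloisRep K (padicCoeffIntegers (∅ : Set (PadicAlgCl 2))) 1)
      (θK ρ : HeckeCharacter K) (r : FramedGaloisRep K (PadicAlgCl 2) 1)
      (Sθ : Finset (HeightOneSpectrum (𝓞 K)))
      (P : W.toAffine.Point) (c₀ : ℕ) (ℓ : ℤ),
      IsImaginaryQuadratic K ∧ ¬ 2 ∣ NumberField.classNumber K ∧ NumberField.discr K = -7 ∧
      ((2 : ℕ) : 𝓞 K) ∈ v.asIdeal ∧ ((2 : ℕ) : 𝓞 K) ∈ vbar.asIdeal ∧ vbar ≠ v ∧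
      (∀ (w : InfinitePlace K) (k : 𝓞 K), k ∈ v.asIdeal ↔ ‖ι.symm (w.embedding (k : K))‖ < 1) ∧
      c ≠ 1 ∧
      ψ.HasInfinityType (fun _ ↦ 1) (fun _ ↦ 0) ∧
      (∀ s : ℂ, 3 / 2 < s.re → heckeLFunction ψ s = W.LSeries s) ∧
      ZpExtension.IsTopGeneratorPair κ₁ κ₂ γ₁ γ₂ ∧ κ₂.IsUnramifiedOutside vbar ∧
      κ₁.IsUnramifiedOutside v ∧ γ₁ ∈ GreenbergSelmer.inertia v ∧ γ₂ ∈ GreenbergSelmer.inertia vbar ∧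
      (∀ σ : absoluteGaloisGroup K, θ σ ^ 2 = 1) ∧ KellerYin2024.IsHeckeCharOf ι θ θK ∧ θK * θK = 1 ∧
      IsPAdicAvatarOf ι ρ r ∧ FactorsThroughPair κ₁ κ₂ r ∧ θK⁻¹ * ρ = (HeckeCharacter.galConj c ψ)⁻¹ ∧
      v ∉ Sθ ∧ vbar ∉ Sθ ∧ (∀ w ∈ Sθ, ¬ θK.IsUnramifiedAt w) ∧
      (∀ w : HeightOneSpectrum (𝓞 K), w ∉ Sθ → w ≠ v → w ≠ vbar → θK.IsUnramifiedAt w) ∧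
      (∀ G₂ : PowerSeries (PowerSeries (PadicComplexInt 2)), ∃ val : ℂ_[2],
        IntSeries.HasValueAt₂ G₂ (avatarValueAt r γ₁⁻¹ - 1) (avatarValueAt r γ₂⁻¹ - 1) val) ∧
      ¬ IsOfFinAddOrder P ∧
      (∀ R : W.toAffine.Point, ∃ (k : ℤ) (T : W.toAffine.Point), IsOfFinAddOrder T ∧ R = k • P + T) ∧
      c₀ ≠ 0 ∧ (W.baseChange ℚ_[2]).IsInReductionKernel (c₀ • W.toPadicPoint 2 P) ∧
      ‖(W.baseChange ℚ_[2]).padicLogPoint (c₀ • W.toPadicPoint 2 P) / (c₀ : ℚ_[2])‖ = (2 : ℝ) ^ (-ℓ) ∧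
      Finite W.sha := by
  intro hGZK hDeu d hd0 hsq hd4 W _ _ C hCW hr
  -- (a) the frame field data, verbatim as in `RubinValueTwo.stub_katzFrame_two` (p637259)
  have hdQ : (d : ℚ) ≠ 0 := by exact_mod_cast hd0
  haveI := cm7.isElliptic_quadraticTwist hdQ
  obtain ⟨hWj, hjm, hcm, -, -⟩ := FramePinning.cm_data_of_smul_eq_cm7Twist W hd0 hCW
  obtain ⟨K, _, _, h2, hdK⟩ :=
    Literature.NumberTheory.QuadraticFields.Quadratic.exists_numberField_discr_eq (D := -7)
      (Or.inl ⟨by norm_num, by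
        rw [← Int.squarefree_natAbs]
        exact (Nat.prime_iff.mp (by norm_num : Nat.Prime 7)).squarefree, by norm_num⟩)
  have hK : IsImaginaryQuadratic K :=
    isImaginaryQuadratic_iff_discr_neg.mpr ⟨h2, by rw [hdK]; norm_num⟩
  have hKj : IsCMFieldOfJ K W.j := by
    obtain ⟨-, -, θ, -, hθ⟩ :=
      Literature.NumberTheory.QuadraticFields.Quadratic.exists_sq_eq_discr (K := K) h2
    refine ⟨h2, (θ : K), ?_⟩
    have h := congrArg (algebraMap (𝓞 K) K) hθ
    rw [hdK, map_pow, map_intCast] at h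
    rw [hcm]
    exact h
  have hs : Summit.BirchSwinnertonDyer.Rank1Residual.X11b.SplitsIn K 2 := by
    unfold Summit.BirchSwinnertonDyer.Rank1Residual.X11b.SplitsIn
    rw [Nat.cast_ofNat, Literature.NumberTheory.QuadraticFields.Quadratic.ncard_primesOver_two_eq_two_iff h2, hdK]
    decide
  obtain ⟨v, hv⟩ :=
    Literature.NumberTheory.Automorphic.PatchingFamily.exists_heightOneSpectrum_natCast_mem K Nat.prime_two
  obtain ⟨c, vbar, hcv, hne, hvbar, -⟩ :=
    Summit.BirchSwinnertonDyer.Rank1Residual.X11b.LocalIndexTransport.exists_conj_prime_of_splitsIn K 2 h2 hs hv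
  have hc : c ≠ 1 := by
    rintro rfl
    rw [one_smul] at hcv
    exact hne hcv.symm
  obtain ⟨ι₀⟩ := PadicAlgCl.nonempty_ringEquiv_complex 2
  obtain ⟨ι, -, hι⟩ := Summit.BirchSwinnertonDyer.Rank1Residual.X11b.exists_datum_forall_mem_iff 2 ι₀ hK hv
  obtain ⟨ψ, hψinf, hψconj, -, -, hψL⟩ := hDeu W hjm K hKj c hc
  -- (b) `2 ∤ h_K` at the frame field (-w6)
  have h2K : ¬ 2 ∣ NumberField.classNumber K :=
    FramePinning.not_two_dvd_classNumber_of_frame hd0 hCW hK hv hvbar hne hψL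
  -- (c″) the DOUBLY-ADAPTED generator pair at `2`: `κ₁` := THE line unramified outside `v`, `κ₂` := THE line unramified
  -- outside `v̄`, generators in the chosen inertia groups (-w2 g13, `DoublyAdaptedPair.exists_doublyAdapted_isTopGeneratorPair_two`)
  obtain ⟨κ₁, κ₂, γ₁, γ₂, hκ₁, hκ₂, hγ₁, hγ₂, hpair⟩ :=
    DoublyAdaptedPair.exists_doublyAdapted_isTopGeneratorPair_two hK h2K hv hvbar hne
  -- (d)(e) the quadratic-part socket
  obtain ⟨θ, θK, ρ, r, Sθ, hθ2, hθθK, hθK, hρr, hrpair, hρ, hvS, hvbarS, hSram, hSunr, hn₁, hn₂⟩ :=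
    hQ d hd0 W C hCW K hK v vbar hv hvbar hne ι hι c hc ψ hψinf hψconj hψL κ₁ κ₂ γ₁ γ₂ hpair
  -- (f) values exist on the open bidisc (B14)
  have hval : ∀ G₂ : PowerSeries (PowerSeries (PadicComplexInt 2)), ∃ val : ℂ_[2],
      IntSeries.HasValueAt₂ G₂ (avatarValueAt r γ₁⁻¹ - 1) (avatarValueAt r γ₂⁻¹ - 1) val :=
    fun G₂ ↦ KatzMeasureValue.exists_hasValueAt₂_of_norm_lt_one G₂ hn₁ hn₂
  -- the Mordell–Weil generator (rank one from GZK) and the formal-group clause, as in p637259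
  have hrank : W.mordellWeilRank = 1 := by rw [(hGZK W hr.le).1, hr]
  have hsha : Finite W.sha := (hGZK W hr.le).2
  obtain ⟨P, hP, hgen⟩ := exists_generator_of_mordellWeilRank_eq_one W hrank
  have hP' : ¬ IsOfFinAddOrder P := by convert hP
  have hgen' : ∀ R : W.toAffine.Point, ∃ (k : ℤ) (T : W.toAffine.Point), IsOfFinAddOrder T ∧ R = k • P + T := by
    intro R
    obtain ⟨a, t, ht, hR⟩ := hgen R
    exact ⟨a, t, by convert ht, by convert hR⟩
  obtain ⟨c₀, ℓ, hc₀, hker, hnorm⟩ := RubinValueTwo.exists_index_padicLog_two W hP'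
  exact ⟨K, inferInstance, inferInstance, v, vbar, ι, c, ψ, κ₁, κ₂, γ₁, γ₂, θ, θK, ρ, r, Sθ, P, c₀, ℓ, hK, h2K, hdK, hv, hvbar, hne,
    hι, hc, hψinf, hψL, hpair, hκ₂, hκ₁, hγ₁, hγ₂, hθ2, hθθK, hθK, hρr, hrpair, hρ, hvS, hvbarS, hSram, hSunr, hval, hP', hgen',
    hc₀, hker, hnorm, hsha⟩

end Summit.BirchSwinnertonDyer.BirchSwinnertonDyer.Theorems.PrintCf2.RubinValueTwoV10

end
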